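/-
Copyright (c) 2026 the pub-hodgecm-mathlib formalisation cell (harness21).  Prover seat hodgecm-mathlib-K2E3-p23 (g2): Track B «K2-LIT», engine E3, line (ii′)
«H-side central germ expansion» (line lead K2E4-p06 (g2)), leaf (E) `sig_K2E3CentralGermExpansionExistence`, brick (E2) «STRATA₂» — the one-place dictionary at `N = 2`; 2026-09-04.
-/
import Literature.NumberTheory.Rogawski1990.UnitaryTwoOneCentralUnipotentClassesFiniteCM   -- ★ p855739 (E1) ‹U-FIN₂› (this seat); brings ★ `localNonsplitEquiv`, `coe_coe_localNonsplitEquiv_apply`, `antidiagOne_map`, `antidiagOne_eq_over`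
import HarnessLib

/-!
# The one-place dictionary of `U(Φ₂)(L⁺_v)` at a non-split place, rank `N = 2`, frame `T = 1` (Platonov–Rapinchuk §5.1; Rogawski 1990 §1.9, §3.9)

Topic `NumberTheory/Rogawski1990`; namespace `Literature.NumberTheory.Rogawski1990`.  THEOREMS ONLY (no definition, no instance, no notation, no named fact, no `sorry`);
kernel lane `--supports stmt-HodgeConjecture-24833`.  Cell `pub/hodgecm-mathlib` (D-0151), crux H413 = `stmt-HodgeConjecture-24833`; Track B «K2-LIT», engine E3
`K2_E3_EllipticInputs`, tier-1 unit `…Sigs_U3bCentralGerms` (ED. 3), line (ii′) «H-side central germ expansion» (line lead K2E4-p06 (g2)), leaf **(E)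
`sig_K2E3CentralGermExpansionExistence`**, brick **(E2) «STRATA₂»** of K2E3-p23 (g2)'s programme (E1) ★ p855739 · (E2) · (E3) · (E4) · (E5): this file is the reusable
DICTIONARY `ψ : U(Φ₂)(L⁺_v) → U(σ_w, J₀)(L_w) ≤ GL₂(L_w)`, `ψ y := localNonsplitEquiv … y` read in `GL₂(L_w)` — the `N = 2` twins of ★ `UnitaryThreeUnipotentStrataCM` §2 ∕ ★
`UnipotentLevelPiecesFrameCM` §3 (which are typed at `N = 3`): `placeForm Φ₂ w = (StdForm.antidiagonal 2).over L_w` (frame `T = 1`), membership, continuity,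
`(y − 1)^n = 0 ↔ (ψ y − 1)^n = 0`, `ψ y = 1 ↔ y = 1`, `IsConj u γ ↔ ∃ k ∈ U(σ_w, J₀), k·ψ u·k⁻¹ = ψ γ`.  Consumers: the sequel `UnitaryTwoOneCentralUnipotentStrataCM` ((S1₂)(S2₂) and the
closed enumeration on `H_v` at a central `z`), then ‹RAO₂›, ‹DUAL₂› and the plug of leaf (E).
HONEST LABEL: HC_CM is proved only modulo the 7 printed citations (2 remaining named inputs: hLiu418 = stmt-HodgeConjecture-24832, h413 = stmt-HodgeConjecture-24833) until rung 0
closes; count-neutral bookkeeping.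

* `placeForm_antidiagTwo_eq_over`, `coe_localNonsplitEquiv_two_mem`, `continuous_coe_localNonsplitEquiv_two`, `sub_one_pow_eq_zero_iff_coe_localNonsplitEquiv_two`,
  `coe_localNonsplitEquiv_two_eq_one_iff`, `isConj_iff_exists_conj_coe_localNonsplitEquiv_two`.

## References
* [Rogawski1990] J. D. Rogawski, *Automorphic Representations of Unitary Groups in Three Variables*, Ann. of Math. Stud. 123 (1990): §1.9–§1.10 pp. 8–9 (`U(2)`, `Φ₂`), §3.9 p. 32.
* [PlatonovRapinchuk1994] V. Platonov, A. Rapinchuk, *Algebraic Groups and Number Theory* (1994), §5.1 (`U(J)(F_v) = U(σ_w, J)(E_w)` at a non-split place).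
* [Mok2014] C. P. Mok, *Endoscopic classification of representations of quasi-split unitary groups*, Mem. AMS 235 (2015), §1 Notation p. 5 (the form `J_N`).
-/

set_option autoImplicit false

noncomputable section

open scoped Matrix MatrixGroups Classical Valued
open NumberField IsDedekindDomain Matrix Set Topology

namespace Literature.NumberTheory.Rogawski1990

open Literature.NumberTheory.Automorphic Literature.NumberTheory.Automorphic.UnitaryGroup Literature.NumberTheory.GaloisRepresentations
open Literature.NumberTheory.Automorphic.HermitianLattice Literature.NumberTheory.LocalFields

/-! ## §1 The one-place dictionary at `N = 2` (frame `T = 1`) -/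

section Dictionary

variable (L : Type) [Field L] [NumberField L] [IsCMField L] {v : HeightOneSpectrum (𝓞 ↥(maximalRealSubfield L))} (w : UnitaryGroup.PlacesOver L v)
  (hw : IsCMField.complexConj L • w.1 = w.1)

omit [IsCMField L] in
/-- The frame of `Φ₂` at `w` is trivial: `(Φ₂)_w = (StdForm.antidiagonal 2).over L_w` (the Summits-side ★ `F0P3cCMLocalNonsplitBorelTransportU2.placeForm_antidiagTwo_eq` states the
same; restated because `Literature` cannot import `Summits`; cf. ★ `CMLocalRankOneClassMapOpen.placeForm_antidiagTwo_eq` with the literal matrix). [cite: Rogawski1990, §1.9 p. 8] -/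
theorem placeForm_antidiagTwo_eq_over :
    placeForm (Matrix.of fun i j : Fin 2 => if i.val + j.val + 1 = 2 then (1 : L) else 0) w.1 = (StdForm.antidiagonal 2).over (w.1.adicCompletion L) := by
  rw [placeForm, antidiagOne_map]
  exact antidiagOne_eq_over (w.1.adicCompletion L) 2

/-- `ψ y ∈ U(σ_w, J₀)(L_w)`. [cite: PlatonovRapinchuk1994, §5.1] -/
theorem coe_localNonsplitEquiv_two_mem (y : (cmDatum L 2 (Matrix.of fun i j : Fin 2 => if i.val + j.val + 1 = 2 then (1 : L) else 0)).Local v) :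
    ((localNonsplitEquiv (IsCMField.complexConj L) (Matrix.of fun i j : Fin 2 => if i.val + j.val + 1 = 2 then (1 : L) else 0) (IsCMField.complexConj_ne_one L) w hw y :
      ↥(unitaryGroupOfForm (galAdicCompletionMap (L := L) (IsCMField.complexConj L) hw) (placeForm (Matrix.of fun i j : Fin 2 => if i.val + j.val + 1 = 2 then (1 : L) else 0) w.1))) :
        GL (Fin 2) (w.1.adicCompletion L)) ∈ unitaryGroupOfForm (galAdicCompletionMap (L := L) (IsCMField.complexConj L) hw) ((StdForm.antidiagonal 2).over (w.1.adicCompletion L)) := by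
  rw [← placeForm_antidiagTwo_eq_over L w]
  exact (localNonsplitEquiv (IsCMField.complexConj L) _ (IsCMField.complexConj_ne_one L) w hw y).2

/-- `ψ` is continuous into `GL₂(L_w)`. [cite: PlatonovRapinchuk1994, §5.1] -/
theorem continuous_coe_localNonsplitEquiv_two :
    Continuous fun y : (cmDatum L 2 (Matrix.of fun i j : Fin 2 => if i.val + j.val + 1 = 2 then (1 : L) else 0)).Local v =>
      ((localNonsplitEquiv (IsCMField.complexConj L) (Matrix.of fun i j : Fin 2 => if i.val + j.val + 1 = 2 then (1 : L) else 0) (IsCMField.complexConj_ne_one L) w hw y :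
        ↥(unitaryGroupOfForm (galAdicCompletionMap (L := L) (IsCMField.complexConj L) hw) (placeForm (Matrix.of fun i j : Fin 2 => if i.val + j.val + 1 = 2 then (1 : L) else 0) w.1))) :
          GL (Fin 2) (w.1.adicCompletion L)) := by
  obtain ⟨E, hE⟩ : ∃ E : (cmDatum L 2 (Matrix.of fun i j : Fin 2 => if i.val + j.val + 1 = 2 then (1 : L) else 0)).Local v ≃ₜ*
      ↥(unitaryGroupOfForm (galAdicCompletionMap (L := L) (IsCMField.complexConj L) hw) (placeForm (Matrix.of fun i j : Fin 2 => if i.val + j.val + 1 = 2 then (1 : L) else 0) w.1)),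
      ∀ g, ((E g : ↥(unitaryGroupOfForm (galAdicCompletionMap (L := L) (IsCMField.complexConj L) hw) (placeForm (Matrix.of fun i j : Fin 2 => if i.val + j.val + 1 = 2 then (1 : L) else 0) w.1))) :
          GL (Fin 2) (w.1.adicCompletion L)) =
        ((localNonsplitEquiv (IsCMField.complexConj L) (Matrix.of fun i j : Fin 2 => if i.val + j.val + 1 = 2 then (1 : L) else 0) (IsCMField.complexConj_ne_one L) w hw g :
          ↥(unitaryGroupOfForm (galAdicCompletionMap (L := L) (IsCMField.complexConj L) hw) (placeForm (Matrix.of fun i j : Fin 2 => if i.val + j.val + 1 = 2 then (1 : L) else 0) w.1))) :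
            GL (Fin 2) (w.1.adicCompletion L)) :=
    ⟨localNonsplitEquiv (IsCMField.complexConj L) _ (IsCMField.complexConj_ne_one L) w hw, fun _ => rfl⟩
  have h : Continuous fun y : (cmDatum L 2 (Matrix.of fun i j : Fin 2 => if i.val + j.val + 1 = 2 then (1 : L) else 0)).Local v =>
      ((E y : ↥(unitaryGroupOfForm (galAdicCompletionMap (L := L) (IsCMField.complexConj L) hw) (placeForm (Matrix.of fun i j : Fin 2 => if i.val + j.val + 1 = 2 then (1 : L) else 0) w.1))) :
        GL (Fin 2) (w.1.adicCompletion L)) :=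
    continuous_subtype_val.comp E.continuous
  simp only [hE] at h
  exact h

/-- **Unipotency through `ψ`, both ways** (one place above `v`): `(y − 1)^n = 0` in `GL₂(L ⊗ L⁺_v)` iff `(ψ y − 1)^n = 0` in `GL₂(L_w)`. [cite: Rogawski1990, §3.9 p. 32] -/
theorem sub_one_pow_eq_zero_iff_coe_localNonsplitEquiv_two (hsub : Subsingleton (UnitaryGroup.PlacesOver L v))
    (y : (cmDatum L 2 (Matrix.of fun i j : Fin 2 => if i.val + j.val + 1 = 2 then (1 : L) else 0)).Local v) (n : ℕ) :
    ((y.val : GL (Fin 2) (UnitaryGroup.LocalRing L v)).val - 1) ^ n = 0 ↔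
      ((((localNonsplitEquiv (IsCMField.complexConj L) (Matrix.of fun i j : Fin 2 => if i.val + j.val + 1 = 2 then (1 : L) else 0) (IsCMField.complexConj_ne_one L) w hw y :
        ↥(unitaryGroupOfForm (galAdicCompletionMap (L := L) (IsCMField.complexConj L) hw) (placeForm (Matrix.of fun i j : Fin 2 => if i.val + j.val + 1 = 2 then (1 : L) else 0) w.1))) :
          GL (Fin 2) (w.1.adicCompletion L)) : Matrix (Fin 2) (Fin 2) (w.1.adicCompletion L)) - 1) ^ n = 0 := by
  rw [coe_coe_localNonsplitEquiv_apply]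
  constructor
  · intro h
    have h' : ((Pi.evalRingHom (fun w' : UnitaryGroup.PlacesOver L v => w'.1.adicCompletion L) w).mapMatrix (((y.val : GL (Fin 2) (UnitaryGroup.LocalRing L v)).val - 1) ^ n)) = 0 := by
      rw [h, map_zero]
    rw [map_pow, map_sub, map_one, RingHom.mapMatrix_apply] at h'
    exact h'
  · intro h
    have h' : ((Pi.evalRingHom (fun w' : UnitaryGroup.PlacesOver L v => w'.1.adicCompletion L) w).mapMatrix (((y.val : GL (Fin 2) (UnitaryGroup.LocalRing L v)).val - 1) ^ n)) = 0 := by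
      rw [map_pow, map_sub, map_one, RingHom.mapMatrix_apply]; exact h
    refine Matrix.ext fun i j => funext fun w' => ?_
    obtain rfl : w = w' := Subsingleton.elim w w'
    have hij := congrFun (congrFun h' i) j
    rw [RingHom.mapMatrix_apply, Matrix.map_apply] at hij
    exact hij

/-- `ψ y = 1 ↔ y = 1`. [cite: PlatonovRapinchuk1994, §5.1] -/
theorem coe_localNonsplitEquiv_two_eq_one_iff (y : (cmDatum L 2 (Matrix.of fun i j : Fin 2 => if i.val + j.val + 1 = 2 then (1 : L) else 0)).Local v) :
    ((localNonsplitEquiv (IsCMField.complexConj L) (Matrix.of fun i j : Fin 2 => if i.val + j.val + 1 = 2 then (1 : L) else 0) (IsCMField.complexConj_ne_one L) w hw y :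
      ↥(unitaryGroupOfForm (galAdicCompletionMap (L := L) (IsCMField.complexConj L) hw) (placeForm (Matrix.of fun i j : Fin 2 => if i.val + j.val + 1 = 2 then (1 : L) else 0) w.1))) :
        GL (Fin 2) (w.1.adicCompletion L)) = 1 ↔ y = 1 := by
  have h1 : ((localNonsplitEquiv (IsCMField.complexConj L) (Matrix.of fun i j : Fin 2 => if i.val + j.val + 1 = 2 then (1 : L) else 0) (IsCMField.complexConj_ne_one L) w hw 1 :
      ↥(unitaryGroupOfForm (galAdicCompletionMap (L := L) (IsCMField.complexConj L) hw) (placeForm (Matrix.of fun i j : Fin 2 => if i.val + j.val + 1 = 2 then (1 : L) else 0) w.1))) :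
        GL (Fin 2) (w.1.adicCompletion L)) = 1 :=
    congrArg Subtype.val (map_one (localNonsplitEquiv (IsCMField.complexConj L) _ (IsCMField.complexConj_ne_one L) w hw))
  constructor
  · intro h
    exact (localNonsplitEquiv (IsCMField.complexConj L) _ (IsCMField.complexConj_ne_one L) w hw).injective (Subtype.ext (h.trans h1.symm))
  · rintro rfl
    exact h1

/-- **`IsConj` through `ψ`**: `u ∼ γ` in `U(Φ₂)(L⁺_v)` iff `k·ψ u·k⁻¹ = ψ γ` for some `k ∈ U(σ_w, J₀)(L_w)`. [cite: Rogawski1990, §3.9 p. 32] -/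
theorem isConj_iff_exists_conj_coe_localNonsplitEquiv_two (u γ : (cmDatum L 2 (Matrix.of fun i j : Fin 2 => if i.val + j.val + 1 = 2 then (1 : L) else 0)).Local v) :
    IsConj u γ ↔ ∃ k : GL (Fin 2) (w.1.adicCompletion L), k ∈ unitaryGroupOfForm (galAdicCompletionMap (L := L) (IsCMField.complexConj L) hw) ((StdForm.antidiagonal 2).over (w.1.adicCompletion L)) ∧
      k * ((localNonsplitEquiv (IsCMField.complexConj L) (Matrix.of fun i j : Fin 2 => if i.val + j.val + 1 = 2 then (1 : L) else 0) (IsCMField.complexConj_ne_one L) w hw u :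
        ↥(unitaryGroupOfForm (galAdicCompletionMap (L := L) (IsCMField.complexConj L) hw) (placeForm (Matrix.of fun i j : Fin 2 => if i.val + j.val + 1 = 2 then (1 : L) else 0) w.1))) :
          GL (Fin 2) (w.1.adicCompletion L)) * k⁻¹ =
      ((localNonsplitEquiv (IsCMField.complexConj L) (Matrix.of fun i j : Fin 2 => if i.val + j.val + 1 = 2 then (1 : L) else 0) (IsCMField.complexConj_ne_one L) w hw γ :
        ↥(unitaryGroupOfForm (galAdicCompletionMap (L := L) (IsCMField.complexConj L) hw) (placeForm (Matrix.of fun i j : Fin 2 => if i.val + j.val + 1 = 2 then (1 : L) else 0) w.1))) :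
          GL (Fin 2) (w.1.adicCompletion L)) := by
  obtain ⟨ψ, hψ⟩ : ∃ ψ : (cmDatum L 2 (Matrix.of fun i j : Fin 2 => if i.val + j.val + 1 = 2 then (1 : L) else 0)).Local v → GL (Fin 2) (w.1.adicCompletion L), ∀ y, ψ y =
      ((localNonsplitEquiv (IsCMField.complexConj L) (Matrix.of fun i j : Fin 2 => if i.val + j.val + 1 = 2 then (1 : L) else 0) (IsCMField.complexConj_ne_one L) w hw y :
        ↥(unitaryGroupOfForm (galAdicCompletionMap (L := L) (IsCMField.complexConj L) hw)
          (placeForm (Matrix.of fun i j : Fin 2 => if i.val + j.val + 1 = 2 then (1 : L) else 0) w.1))) : GL (Fin 2) (w.1.adicCompletion L)) :=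
    ⟨_, fun _ => rfl⟩
  have hψmul : ∀ y y', ψ (y * y') = ψ y * ψ y' := fun y y' => by
    rw [hψ, hψ, hψ]
    exact congrArg Subtype.val (map_mul (localNonsplitEquiv (IsCMField.complexConj L) _ (IsCMField.complexConj_ne_one L) w hw) y y')
  have hψinv : ∀ y, ψ y⁻¹ = (ψ y)⁻¹ := fun y => by
    rw [hψ, hψ]
    exact congrArg Subtype.val (map_inv (localNonsplitEquiv (IsCMField.complexConj L) _ (IsCMField.complexConj_ne_one L) w hw) y)
  have hψinj : ∀ y y', ψ y = ψ y' → y = y' := fun y y' h => by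
    rw [hψ, hψ] at h
    exact (localNonsplitEquiv (IsCMField.complexConj L) _ (IsCMField.complexConj_ne_one L) w hw).injective (Subtype.ext h)
  rw [← hψ u, ← hψ γ, isConj_iff]
  constructor
  · rintro ⟨d, hd⟩
    refine ⟨ψ d, ?_, by rw [← hψmul, ← hψinv, ← hψmul, hd]⟩
    rw [hψ]
    exact coe_localNonsplitEquiv_two_mem L w hw d
  · rintro ⟨k, hk, hconj⟩
    have hk' : k ∈ unitaryGroupOfForm (galAdicCompletionMap (L := L) (IsCMField.complexConj L) hw)
        (placeForm (Matrix.of fun i j : Fin 2 => if i.val + j.val + 1 = 2 then (1 : L) else 0) w.1) := by rw [placeForm_antidiagTwo_eq_over L w]; exact hk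
    obtain ⟨d, hd⟩ : ∃ d : (cmDatum L 2 (Matrix.of fun i j : Fin 2 => if i.val + j.val + 1 = 2 then (1 : L) else 0)).Local v, ψ d = k :=
      ⟨(localNonsplitEquiv (IsCMField.complexConj L) _ (IsCMField.complexConj_ne_one L) w hw).symm ⟨k, hk'⟩, by
        rw [hψ]
        exact congrArg Subtype.val ((localNonsplitEquiv (IsCMField.complexConj L) _ (IsCMField.complexConj_ne_one L) w hw).apply_symm_apply ⟨k, hk'⟩)⟩
    refine ⟨d, hψinj _ _ ?_⟩
    rw [hψmul, hψmul, hψinv, hd, hconj]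

end Dictionary

end Literature.NumberTheory.Rogawski1990

end
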